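import Mathlib
import Literature.MathematicalPhysics.QuantumLattice.HubbardBandSectorCountingToolbox
import Literature.MathematicalPhysics.QuantumLattice.HubbardUmklappKinematics
import Summits.HubbardSuperconductivity.HubbardSuperconductivity.Theorems.KLProgrammeKLRegimeTwoPointLimitShellCooperExplicit
import HarnessLib

/-!
# Route `KLProgramme` — crux K3 `KLRegimeTwoPointLimit` (stmt-HubbardSuperconductivity-19937), support:
# Lemmas E.1 / E.3 PACKAGED — the angular measure bound for every transfer, with constants depending
# only on the band window (DECOMP App. E; the form Lemma E.4, C3 and U5′ consume)

Cell `gate-hubbard-kl`, seat p1b; paper note `HOME/prover-p1b/E1-NOTE.md` §2 (second display) and §4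
(constants). The seat's earlier files prove the angular bound of the translated band Fermi curve
`Θ_w(δ) = {θ ∈ [θ₀, θ₀ + 2π] : |ε(p_μ(θ) - w) - μ| ≤ δ}` in three regimes under EXPLICIT parameter
inequalities: `klse_volume_sublevel_le_cooper_explicit` (Cooper point, linear law `δ/|w|_∞`) and
`klsh_volume_sublevel_le_caustic` (everything at torus distance `≥ v` from the Cooper point, incl. the
`2k_F` caustic: `O(δ) + O(√δ)`). This file DISCHARGES those parameter inequalities once and for all:
for a level `μ` with margin `η⋆` inside the range of a `BandBounds a b` bundle,

* `klan_exists_cooper_bound` — there are `v, δ₁, C > 0` (depending only on `B`, `η⋆`) with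
  `|Θ_w(δ)| ≤ C·δ/|w|_∞` for all `0 < |w|_∞ ≤ v`, `0 < δ ≤ δ₁` (no restriction `δ ≲ |w|`: the
  complementary case is the trivial bound `2π`);
* (companion file `…ShellAngularBoundAway`: `klan_exists_away_bound` — for every `v > 0` there are
  `δ₁, C₁, C₂ > 0` with `|Θ_w(δ)| ≤ C₁·δ + C₂·√δ` for all `w` at torus sup-distance `≥ v` from
  `2πℤ²`, `0 < δ ≤ δ₁` — the `ε₂^{1/2}` law of Lemma E.3, uniformly up to and on the caustic);
* `klan_sublevel_eq_of_sub_int_mul`, `klan_exists_cell_rep` — `2π`-periodicity in the transfer and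
  the cell representative, so that the two regimes cover every `w ∈ ℝ²`.

The explicit choices (proof of `klan_exists_cooper_bound`): `κ₁ = √2π/ρ_min + 1`,
`κ₂ = (2s²C_g + 1)/Dt_min`, `κ₃ = min(√2 u_min, 2π - 2K(b))` (the separation of the Cooper point
from the caustic on the whole range, via `K(μ) ≤ K(b)`), `v = min(ρ_min/2, κ₃/4, 1/(8κ₁κ₂), 1,
8s²κ₃/(9A₂), η⋆/(4κ₁))`, `δ₁ = η⋆/2`, `C = 20 s C_g + 8πκ₂`. Not here: the two-shell AREA form (a
later file, via `klta_volume_twoShell_le`).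
-/

noncomputable section

-- the tree's namespace `Summit.<Summit>.<Problem>.Theorems` repeats the summit name by design (D-0017)
set_option linter.dupNamespace false

open Real Set MeasureTheory
open scoped ENNReal
open Literature.MathematicalPhysics.QuantumLattice
open Literature.MathematicalPhysics.QuantumLattice.BandSectorCounting

namespace Summit.HubbardSuperconductivity.HubbardSuperconductivity.Theorems

/-! ### Periodicity in the transfer and the cell representative -/

/-- The angular sublevel set of the translated level function is `2πℤ²`-periodic in the transfer
`w`: replacing `w` by `w - 2πm` does not change it (`ε` is `2π`-periodic in each coordinate). -/
theorem klan_sublevel_eq_of_sub_int_mul (μ w₁ w₂ δ : ℝ) (P : Set ℝ) (m₀ m₁ : ℤ) :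
    {θ ∈ P | |eps2 (bandX μ θ - (w₁ - m₀ * (2 * π))) (bandY μ θ - (w₂ - m₁ * (2 * π))) - μ| ≤ δ} =
      {θ ∈ P | |eps2 (bandX μ θ - w₁) (bandY μ θ - w₂) - μ| ≤ δ} := by
  ext θ
  simp only [mem_setOf_eq]
  have h := eps2_sub_int_mul (bandX μ θ - w₁) (bandY μ θ - w₂) (-m₀) (-m₁)
  have e1 : bandX μ θ - (w₁ - m₀ * (2 * π)) = bandX μ θ - w₁ - (((-m₀ : ℤ) : ℝ)) * (2 * π) := by
    push_cast; ring
  have e2 : bandY μ θ - (w₂ - m₁ * (2 * π)) = bandY μ θ - w₂ - (((-m₁ : ℤ) : ℝ)) * (2 * π) := by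
    push_cast; ring
  rw [e1, e2, h]

/-- Every transfer has a CELL REPRESENTATIVE: integers `m₀, m₁` with
`max(|w₁ - 2πm₀|, |w₂ - 2πm₁|) ≤ π`; its sup-norm is then the torus sup-distance of `w` to `2πℤ²`
(`klse_supnorm_le_latticeDist`). -/
theorem klan_exists_cell_rep (w₁ w₂ : ℝ) :
    ∃ m₀ m₁ : ℤ, max |w₁ - m₀ * (2 * π)| |w₂ - m₁ * (2 * π)| ≤ π := by
  obtain ⟨m₀, h₀⟩ := exists_int_abs_sub_le_pi w₁
  obtain ⟨m₁, h₁⟩ := exists_int_abs_sub_le_pi w₂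
  exact ⟨m₀, m₁, max_le h₀ h₁⟩

/-- The trivial bound: an angular sublevel set inside one period has measure `≤ 2π`. -/
theorem klan_volume_sublevel_le_two_pi (μ w₁ w₂ δ θ₀ : ℝ) :
    volume {θ ∈ Icc θ₀ (θ₀ + 2 * π) | |eps2 (bandX μ θ - w₁) (bandY μ θ - w₂) - μ| ≤ δ} ≤
      ENNReal.ofReal (2 * π) := by
  calc volume {θ ∈ Icc θ₀ (θ₀ + 2 * π) | |eps2 (bandX μ θ - w₁) (bandY μ θ - w₂) - μ| ≤ δ}
      ≤ volume (Icc θ₀ (θ₀ + 2 * π)) := measure_mono (fun θ hθ => hθ.1)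
    _ = ENNReal.ofReal (2 * π) := by
        rw [Real.volume_Icc, show θ₀ + 2 * π - θ₀ = 2 * π by ring]

/-! ### The Cooper regime, packaged -/

section Main

variable {a b : ℝ} (B : BandBounds a b)
include B

/-- **Lemma E.1 at the Cooper point, packaged.** For a margin `η⋆ > 0` there are `v, δ₁, C > 0`,
depending only on the bundle `B` and `η⋆`, such that for every level `μ` with `μ ± η⋆` in the range,
every `0 < δ ≤ δ₁`, every transfer in the cell with `0 < |w|_∞ ≤ v`, and every period:
`|{θ ∈ [θ₀, θ₀ + 2π] : |ε(p_μ(θ) - w) - μ| ≤ δ}| ≤ C·δ/|w|_∞` — the sharp LINEAR law (the freezing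
input of Lemma E.4). Proof: `klse_volume_sublevel_le_cooper_explicit` when `δ ≤ |w|_∞/(4κ₂)`
(constant `20 s_max C_g`), the trivial bound `2π ≤ 8πκ₂·δ/|w|_∞` otherwise; `C = 20 s_max C_g + 8πκ₂`,
`κ₂ = (2 s_max² C_g + 1)/Dt_min`. -/
theorem klan_exists_cooper_bound {ηs : ℝ} (hηs : 0 < ηs) :
    ∃ v δ₁ C : ℝ, 0 < v ∧ 0 < δ₁ ∧ 0 < C ∧
      ∀ (μ : ℝ), a ≤ μ - ηs → μ + ηs ≤ b → ∀ (δ w₁ w₂ θ₀ : ℝ), 0 < δ → δ ≤ δ₁ →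
        0 < max |w₁| |w₂| → max |w₁| |w₂| ≤ v →
        volume {θ ∈ Icc θ₀ (θ₀ + 2 * π) | |eps2 (bandX μ θ - w₁) (bandY μ θ - w₂) - μ| ≤ δ} ≤
          ENNReal.ofReal (C * δ / max |w₁| |w₂|) := by
  have hπ := Real.pi_pos
  have hs := B.smax_pos
  have hC := B.Cg_pos
  have hD := B.Dtmin_pos
  have hρ := B.rhomin_pos
  have hA := B.A2_pos
  have hu := B.umin_pos
  have hs' := hs.ne'
  have hC' := hC.ne'
  have hD' := hD.ne'
  have hρ' := hρ.ne'
  have hA' := hA.ne'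
  have hKb : umklappRadius b < π := umklappRadius_lt_pi B.hb
  -- constants (opaque names with defining equations)
  obtain ⟨κ₁, hκ₁⟩ : ∃ x : ℝ, x = Real.sqrt 2 * π / B.rhomin + 1 := ⟨_, rfl⟩
  obtain ⟨κ₂, hκ₂⟩ : ∃ x : ℝ, x = (2 * B.smax ^ 2 * B.Cg + 1) / B.Dtmin := ⟨_, rfl⟩
  obtain ⟨κ₃, hκ₃⟩ : ∃ x : ℝ, x = min (Real.sqrt 2 * B.umin) (2 * π - 2 * umklappRadius b) :=
    ⟨_, rfl⟩
  have hκ₁0 : 0 < κ₁ := by rw [hκ₁]; positivity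
  have hκ₂0 : 0 < κ₂ := by rw [hκ₂]; positivity
  have hκ₃0 : 0 < κ₃ := by rw [hκ₃]; exact lt_min (by positivity) (by linarith)
  have hκ₁' := hκ₁0.ne'
  have hκ₂' := hκ₂0.ne'
  obtain ⟨v, hv⟩ : ∃ x : ℝ, x = min (min (min (min (min (B.rhomin / 2) (κ₃ / 4))
    (1 / (8 * κ₁ * κ₂))) 1) (8 * B.smax ^ 2 * κ₃ / (9 * B.A2))) (ηs / (4 * κ₁)) := ⟨_, rfl⟩
  have hv0 : 0 < v := by
    rw [hv]
    exact lt_min (lt_min (lt_min (lt_min (lt_min (by positivity) (by positivity)) (by positivity))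
      one_pos) (by positivity)) (by positivity)
  have hv1 : v ≤ B.rhomin / 2 := by
    rw [hv]; exact le_trans (min_le_left _ _) (le_trans (min_le_left _ _)
      (le_trans (min_le_left _ _) (le_trans (min_le_left _ _) (min_le_left _ _))))
  have hv2 : v ≤ κ₃ / 4 := by
    rw [hv]; exact le_trans (min_le_left _ _) (le_trans (min_le_left _ _)
      (le_trans (min_le_left _ _) (le_trans (min_le_left _ _) (min_le_right _ _))))
  have hv3 : v ≤ 1 / (8 * κ₁ * κ₂) := by
    rw [hv]; exact le_trans (min_le_left _ _) (le_trans (min_le_left _ _)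
      (le_trans (min_le_left _ _) (min_le_right _ _)))
  have hv4 : v ≤ 1 := by
    rw [hv]; exact le_trans (min_le_left _ _) (le_trans (min_le_left _ _) (min_le_right _ _))
  have hv5 : v ≤ 8 * B.smax ^ 2 * κ₃ / (9 * B.A2) := by
    rw [hv]; exact le_trans (min_le_left _ _) (min_le_right _ _)
  have hv6 : v ≤ ηs / (4 * κ₁) := by rw [hv]; exact min_le_right _ _
  obtain ⟨C, hCdef⟩ : ∃ x : ℝ, x = 20 * B.smax * B.Cg + 8 * π * κ₂ := ⟨_, rfl⟩
  have hC0 : 0 < C := by rw [hCdef]; positivity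
  refine ⟨v, ηs / 2, C, hv0, by positivity, hC0, ?_⟩
  intro μ hlo hhi δ w₁ w₂ θ₀ hδ hδ₁ hw0 hwv
  have hμ : μ ∈ Icc a b := ⟨by linarith, by linarith⟩
  obtain ⟨rinf, hrinf⟩ : ∃ x : ℝ, x = max |w₁| |w₂| := ⟨_, rfl⟩
  rw [← hrinf] at hw0 hwv ⊢
  have hw0' := hw0.ne'
  -- elementary facts about `w`
  have hw1 : |w₁| ≤ rinf := hrinf ▸ le_max_left _ _
  have hw2 : |w₂| ≤ rinf := hrinf ▸ le_max_right _ _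
  have hrv1 : rinf ≤ 1 := hwv.trans hv4
  have hsq : w₁ ^ 2 + w₂ ^ 2 ≤ 2 * rinf ^ 2 := by
    have e1 : |w₁| ^ 2 ≤ rinf ^ 2 := pow_le_pow_left₀ (abs_nonneg _) hw1 2
    have e2 : |w₂| ^ 2 ≤ rinf ^ 2 := pow_le_pow_left₀ (abs_nonneg _) hw2 2
    rw [sq_abs] at e1 e2
    linarith
  have hrsq : rinf ^ 2 ≤ rinf := by rw [sq]; exact mul_le_of_le_one_right hw0.le hrv1
  have hsq1 : w₁ ^ 2 + w₂ ^ 2 ≤ 2 * rinf := by linarith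
  have hr0 : 0 < Real.sqrt (w₁ ^ 2 + w₂ ^ 2) := by
    apply Real.sqrt_pos.2
    rcases lt_max_iff.1 (hrinf ▸ hw0) with h | h
    · have : 0 < w₁ ^ 2 := by rw [← sq_abs]; positivity
      positivity
    · have : 0 < w₂ ^ 2 := by rw [← sq_abs]; positivity
      positivity
  have hr1 : Real.sqrt (w₁ ^ 2 + w₂ ^ 2) < B.rhomin := by
    have h1 : Real.sqrt (w₁ ^ 2 + w₂ ^ 2) ≤ Real.sqrt (2 * rinf ^ 2) := Real.sqrt_le_sqrt hsq
    have h2 : Real.sqrt (2 * rinf ^ 2) = Real.sqrt 2 * rinf := by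
      rw [Real.sqrt_mul (by norm_num), Real.sqrt_sq hw0.le]
    have h3 : Real.sqrt 2 < 2 := by
      have h4 : Real.sqrt 4 = 2 := by
        rw [show (4 : ℝ) = 2 ^ 2 by norm_num, Real.sqrt_sq (by norm_num)]
      rw [← h4]
      exact Real.sqrt_lt_sqrt (by norm_num) (by norm_num)
    have h4 : Real.sqrt 2 * rinf < 2 * rinf := mul_lt_mul_of_pos_right h3 hw0
    linarith [hwv.trans hv1]
  have hr2 : rinf ≤ π := by linarith [Real.pi_gt_three]
  -- `κ₃ ≤ κ₃(μ)`
  have hKμ : umklappRadius μ ≤ umklappRadius b := umklappRadius_mono hμ.2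
  have hκ₃μ : κ₃ ≤ min (Real.sqrt 2 * B.umin) (2 * π - 2 * umklappRadius μ) := by
    rw [hκ₃]; exact le_min (min_le_left _ _) ((min_le_right _ _).trans (by linarith))
  have hr3 : rinf ≤ min (Real.sqrt 2 * B.umin) (2 * π - 2 * umklappRadius μ) / 4 := by
    linarith [hwv.trans hv2]
  -- `hη1`
  have hκ₁w : κ₁ * (w₁ ^ 2 + w₂ ^ 2) ≤ ηs / 2 := by
    have h1 : κ₁ * (w₁ ^ 2 + w₂ ^ 2) ≤ κ₁ * (2 * rinf) := mul_le_mul_of_nonneg_left hsq1 hκ₁0.le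
    have h2 : κ₁ * (2 * rinf) ≤ κ₁ * (2 * (ηs / (4 * κ₁))) :=
      mul_le_mul_of_nonneg_left (by linarith [hwv.trans hv6]) hκ₁0.le
    have h3 : κ₁ * (2 * (ηs / (4 * κ₁))) = ηs / 2 := by field_simp; ring
    linarith
  have hη1 : (Real.sqrt 2 * π / B.rhomin + 1) * (w₁ ^ 2 + w₂ ^ 2) + δ ≤ ηs := by
    rw [← hκ₁]; linarith
  -- `hη3`
  have hη3 : B.A2 / 4 * (3 * rinf / (4 * B.smax)) ^ 2 + rinf / 2 <
      min (Real.sqrt 2 * B.umin) (2 * π - 2 * umklappRadius μ) / 2 := by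
    have e : B.A2 / 4 * (3 * rinf / (4 * B.smax)) ^ 2 = 9 * B.A2 / (64 * B.smax ^ 2) * rinf ^ 2 := by
      field_simp; ring
    have h1 : rinf ^ 2 ≤ rinf * (8 * B.smax ^ 2 * κ₃ / (9 * B.A2)) := by
      rw [sq]; exact mul_le_mul_of_nonneg_left (hwv.trans hv5) hw0.le
    have h2 : 9 * B.A2 / (64 * B.smax ^ 2) * (rinf * (8 * B.smax ^ 2 * κ₃ / (9 * B.A2))) =
        rinf * κ₃ / 8 := by field_simp; ring
    have h3 : 9 * B.A2 / (64 * B.smax ^ 2) * rinf ^ 2 ≤ rinf * κ₃ / 8 := by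
      rw [← h2]; exact mul_le_mul_of_nonneg_left h1 (by positivity)
    have h4 : rinf * κ₃ ≤ κ₃ := mul_le_of_le_one_left hκ₃0.le hrv1
    have h5 : rinf / 2 ≤ κ₃ / 8 := by linarith [hwv.trans hv2]
    rw [e]; linarith
  -- the two cases in `δ`
  rcases le_or_gt δ (rinf / (4 * κ₂)) with hsmall | hlarge
  · -- `δ ≤ rinf/(4κ₂)`: the explicit Cooper bound
    have hη2' : κ₂ * (κ₁ * (w₁ ^ 2 + w₂ ^ 2) + δ) ≤ rinf / 2 := by
      have h1a : κ₁ * (w₁ ^ 2 + w₂ ^ 2) ≤ κ₁ * (2 * rinf ^ 2) :=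
        mul_le_mul_of_nonneg_left hsq hκ₁0.le
      have h1b : rinf ^ 2 ≤ rinf * (1 / (8 * κ₁ * κ₂)) := by
        rw [sq]; exact mul_le_mul_of_nonneg_left (hwv.trans hv3) hw0.le
      have h1c : κ₁ * (2 * (rinf * (1 / (8 * κ₁ * κ₂)))) = rinf / (4 * κ₂) := by
        field_simp; ring
      have h1d : κ₁ * (2 * rinf ^ 2) ≤ κ₁ * (2 * (rinf * (1 / (8 * κ₁ * κ₂)))) :=
        mul_le_mul_of_nonneg_left (by linarith) hκ₁0.le
      have h1 : κ₁ * (w₁ ^ 2 + w₂ ^ 2) ≤ rinf / (4 * κ₂) := by linarith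
      have h2 : κ₂ * (rinf / (4 * κ₂)) = rinf / 4 := by field_simp
      have h3 : κ₂ * δ ≤ κ₂ * (rinf / (4 * κ₂)) := mul_le_mul_of_nonneg_left hsmall hκ₂0.le
      have h4 : κ₂ * (κ₁ * (w₁ ^ 2 + w₂ ^ 2)) ≤ κ₂ * (rinf / (4 * κ₂)) :=
        mul_le_mul_of_nonneg_left h1 hκ₂0.le
      rw [mul_add]; linarith
    have hη2 : (2 * B.smax ^ 2 * B.Cg + 1) / B.Dtmin *
        ((Real.sqrt 2 * π / B.rhomin + 1) * (w₁ ^ 2 + w₂ ^ 2) + δ) ≤ rinf / 2 := by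
      rw [← hκ₂, ← hκ₁]; exact hη2'
    subst hrinf
    have hmain := klse_volume_sublevel_le_cooper_explicit B hμ (θ₀ := θ₀) hlo hhi hr0 hr1 hr2 hr3
      hδ.le hη1 hη2 hη3
    refine hmain.trans ?_
    have e1 : (5 : ℝ≥0∞) * ENNReal.ofReal (δ / (max |w₁| |w₂| / (4 * B.smax * B.Cg))) =
        ENNReal.ofReal (5 * (δ / (max |w₁| |w₂| / (4 * B.smax * B.Cg)))) := by
      rw [ENNReal.ofReal_mul (by norm_num : (0 : ℝ) ≤ 5), ENNReal.ofReal_ofNat]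
    rw [e1]
    apply ENNReal.ofReal_le_ofReal
    have e2 : 5 * (δ / (max |w₁| |w₂| / (4 * B.smax * B.Cg))) =
        20 * B.smax * B.Cg * δ / max |w₁| |w₂| := by
      field_simp; ring
    rw [e2, hCdef]
    apply div_le_div_of_nonneg_right _ hw0.le
    have h0 : 0 ≤ 8 * π * κ₂ * δ := by positivity
    have e : (20 * B.smax * B.Cg + 8 * π * κ₂) * δ = 20 * B.smax * B.Cg * δ + 8 * π * κ₂ * δ := by
      ring
    rw [e]; linarith
  · -- `δ > rinf/(4κ₂)`: the trivial bound
    subst hrinf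
    refine (klan_volume_sublevel_le_two_pi μ w₁ w₂ δ θ₀).trans (ENNReal.ofReal_le_ofReal ?_)
    rw [le_div_iff₀ hw0, hCdef]
    have h1 : max |w₁| |w₂| < 4 * κ₂ * δ := by
      rw [div_lt_iff₀ (by positivity)] at hlarge; linarith
    have h2 : 2 * π * max |w₁| |w₂| ≤ 2 * π * (4 * κ₂ * δ) :=
      mul_le_mul_of_nonneg_left h1.le (by positivity)
    have h3 : 0 ≤ 20 * B.smax * B.Cg * δ := by positivity
    have e : (20 * B.smax * B.Cg + 8 * π * κ₂) * δ = 20 * B.smax * B.Cg * δ + 2 * π * (4 * κ₂ * δ) := by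
      ring
    rw [e]; linarith

end Main

end Summit.HubbardSuperconductivity.HubbardSuperconductivity.Theorems

end
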